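import Literature.Analysis.Complex.LoewnerCriteria

/-!
# Loewner's theorem, Part I — the Hansen–Pedersen lemmas

Third theorem file of the discharge of `Literature.Analysis.Complex.loewner_theorem` (→):
the operator-convexity input of the Hansen–Pedersen proof (F. Hansen, G. K. Pedersen,
*Math. Ann.* 258 (1982); Hiai–Petz (2014) Theorem 4.22, Example 4.24, Lemma 4.34):

* `isMatrixConvexOn_of_proj_jensen`, `proj_jensen_of_isMatrixMonotoneOn` — Jensen's operator
  inequality for projections and the Hansen–Pedersen characterization: a matrix monotone `g` on
  `[0,b)` makes `x g(x)` matrix convex (Hiai–Petz Theorem 4.22 / Example 4.24, finite-dimensional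
  form with block matrices);
* `isMatrixConvexOn_add_one_mul`, `isMatrixConvexOn_sub_one_mul`, `isMatrixConvexOn_add_const_mul`
  — Lemma 4.34 (1): for `f` matrix monotone on `(-1,1)`, `(x ± 1) f(x)` and `(x + α) f(x)`,
  `|α| ≤ 1`, are matrix convex;
* `isMatrixMonotoneOn_add_smul_dd1` — Lemma 4.34 (2) for `C²` functions: `f + α f[·,0]`
  (`= (1 + α/x) f` when `f(0) = 0`) is matrix monotone for `|α| ≤ 1`. Hiai–Petz derive (2) from
  (1) through Kraus' theorem "matrix convex ⇒ `g^{[1]}[·,0]` matrix monotone"; here this is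
  replaced by the approximate sliced Kraus criterion `kraus_qform_ge` and the approximate Löwner
  criterion `qform_aeval_sub_aeval_ge` applied to `C²`-close polynomials, plus the divided
  difference algebra of `(X ± 1)P` and `P + α P/X`.

No definitions, no named facts.
-/

noncomputable section

open Finset Matrix Polynomial

namespace Literature.Analysis.Complex

open scoped ComplexOrder MatrixOrder Matrix.Norms.L2Operator
open Set Filter Topology Polynomial

/-! ### Jensen's operator inequality for projections ⇒ matrix convexity (Hansen–Pedersen) -/

section Jensen

variable {ι κ : Type*} [Fintype ι] [DecidableEq ι] [Fintype κ] [DecidableEq κ]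

/-- Spectrum of a matrix through the determinant. [folklore] -/
theorem mem_spectrum_real_iff_det {Y : Matrix κ κ ℂ} {x : ℝ} :
    x ∈ spectrum ℝ Y ↔ ((x : ℂ) • (1 : Matrix κ κ ℂ) - Y).det = 0 := by
  rw [spectrum.mem_iff, Matrix.isUnit_iff_isUnit_det, isUnit_iff_ne_zero, not_not,
    Algebra.algebraMap_eq_smul_one, real_smul_eq_coe_smul]

/-- Spectrum of a block diagonal matrix. [folklore] -/
theorem spectrum_real_fromBlocks_diag (M : Matrix ι ι ℂ) (N : Matrix κ κ ℂ) :
    spectrum ℝ (Matrix.fromBlocks M 0 0 N) = spectrum ℝ M ∪ spectrum ℝ N := by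
  ext x
  rw [Set.mem_union, mem_spectrum_real_iff_det, mem_spectrum_real_iff_det, mem_spectrum_real_iff_det]
  have : (x : ℂ) • (1 : Matrix (ι ⊕ κ) (ι ⊕ κ) ℂ) - Matrix.fromBlocks M 0 0 N =
      Matrix.fromBlocks ((x : ℂ) • (1 : Matrix ι ι ℂ) - M) 0 0 ((x : ℂ) • (1 : Matrix κ κ ℂ) - N) := by
    ext i j
    rcases i with i | i <;> rcases j with j | j <;>
      simp [Matrix.fromBlocks_apply₁₁, Matrix.fromBlocks_apply₁₂, Matrix.fromBlocks_apply₂₁,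
        Matrix.fromBlocks_apply₂₂, Matrix.one_apply]
  rw [this, Matrix.det_fromBlocks_zero₂₁, mul_eq_zero]

/-- Spectrum is invariant under unitary conjugation. [folklore] -/
theorem spectrum_real_unitary_conj {U : Matrix κ κ ℂ} (hU : star U * U = 1) (Y : Matrix κ κ ℂ) :
    spectrum ℝ (star U * Y * U) = spectrum ℝ Y := by
  ext x
  rw [mem_spectrum_real_iff_det, mem_spectrum_real_iff_det]
  have : (x : ℂ) • (1 : Matrix κ κ ℂ) - star U * Y * U = star U * ((x : ℂ) • (1 : Matrix κ κ ℂ) - Y) * U := by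
    rw [Matrix.mul_sub, Matrix.sub_mul, Matrix.mul_smul, Matrix.mul_one, Matrix.smul_mul, hU]
  rw [this, Matrix.det_mul, Matrix.det_mul, mul_comm (star U).det, mul_assoc, ← Matrix.det_mul, hU,
    Matrix.det_one, mul_one]

/-- Polynomials of a block diagonal matrix (powers of a block diagonal matrix are Mathlib's
`Matrix.fromBlocks_diagonal_pow`). [folklore] -/
theorem aeval_fromBlocks_diag' (M : Matrix ι ι ℂ) (N : Matrix κ κ ℂ) (q : ℝ[X]) :
    aeval (Matrix.fromBlocks M 0 0 N) q = Matrix.fromBlocks (aeval M q) 0 0 (aeval N q) := by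
  simp only [aeval_eq_sum_range, real_smul_eq_coe_smul, Matrix.fromBlocks_diagonal_pow]
  induction (Finset.range (q.natDegree + 1)) using Finset.induction_on with
  | empty => simp [Matrix.fromBlocks_zero]
  | insert a s ha ih =>
    rw [Finset.sum_insert ha, Finset.sum_insert ha, Finset.sum_insert ha, ih, Matrix.fromBlocks_smul,
      Matrix.fromBlocks_add]
    simp

/-- Powers of a unitary conjugate. [folklore] -/
theorem unitary_conj_pow {U : Matrix κ κ ℂ} (hU' : U * star U = 1) (Y : Matrix κ κ ℂ) (k : ℕ) :
    (star U * Y * U) ^ k = star U * Y ^ k * U := by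
  induction k with
  | zero => simp [(mul_eq_one_comm.mp hU')]
  | succ k ih =>
    rw [pow_succ, ih, pow_succ]
    simp only [Matrix.mul_assoc]
    rw [← Matrix.mul_assoc U (star U), hU', Matrix.one_mul]

/-- Auxiliary for the proof of Loewner's theorem
(`aeval_unitary_conj`: aeval unitary conj). [folklore] -/
theorem aeval_unitary_conj {U : Matrix κ κ ℂ} (hU' : U * star U = 1) (Y : Matrix κ κ ℂ) (q : ℝ[X]) :
    aeval (star U * Y * U) q = star U * aeval Y q * U := by
  simp only [aeval_eq_sum_range, real_smul_eq_coe_smul, unitary_conj_pow hU', Finset.mul_sum,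
    Finset.sum_mul, Matrix.mul_smul, Matrix.smul_mul]

/-- `cfc` of a block diagonal Hermitian matrix. [folklore] -/
theorem cfc_fromBlocks_diag' {A : Matrix ι ι ℂ} {B : Matrix κ κ ℂ} (hA : A.IsHermitian)
    (hB : B.IsHermitian) (f : ℝ → ℝ) :
    cfc f (Matrix.fromBlocks A 0 0 B) = Matrix.fromBlocks (cfc f A) 0 0 (cfc f B) := by
  have hC : (Matrix.fromBlocks A 0 0 B).IsHermitian :=
    Matrix.IsHermitian.fromBlocks hA (by simp) hB
  obtain ⟨q, hq⟩ := exists_polynomial_eqOn_of_finite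
    (((Matrix.finite_real_spectrum (A := A)).union (Matrix.finite_real_spectrum (A := B))).union
      (Matrix.finite_real_spectrum (A := Matrix.fromBlocks A 0 0 B))) f
  rw [cfc_congr (hq.mono Set.subset_union_right),
    cfc_congr (hq.mono (Set.subset_union_left.trans Set.subset_union_left)),
    cfc_congr (hq.mono (Set.subset_union_right.trans Set.subset_union_left))]
  erw [cfc_polynomial q _ (hC : IsSelfAdjoint _), cfc_polynomial q _ (hA : IsSelfAdjoint _),
    cfc_polynomial q _ (hB : IsSelfAdjoint _)]
  exact aeval_fromBlocks_diag' A B q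

/-- `cfc` commutes with unitary conjugation. [folklore] -/
theorem cfc_unitary_conj' {U Y : Matrix κ κ ℂ} (hU : star U * U = 1) (hY : Y.IsHermitian) (f : ℝ → ℝ) :
    cfc f (star U * Y * U) = star U * cfc f Y * U := by
  have hU' : U * star U = 1 := mul_eq_one_comm.mp hU
  have hYc : (star U * Y * U).IsHermitian := Matrix.isHermitian_conjTranspose_mul_mul U hY
  obtain ⟨q, hq⟩ := exists_polynomial_eqOn_of_finite
    ((Matrix.finite_real_spectrum (A := Y)).union (Matrix.finite_real_spectrum (A := star U * Y * U))) f
  rw [cfc_congr (hq.mono Set.subset_union_right), cfc_congr (hq.mono Set.subset_union_left)]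
  erw [cfc_polynomial q _ (hYc : IsSelfAdjoint _), cfc_polynomial q _ (hY : IsSelfAdjoint _)]
  exact aeval_unitary_conj hU' Y q

end Jensen

end Literature.Analysis.Complex

namespace Literature.Analysis.Complex

open scoped ComplexOrder MatrixOrder Matrix.Norms.L2Operator
open Set Filter Topology Polynomial

section Jensen2

variable {ι : Type*} [Fintype ι] [DecidableEq ι]

/-- `cfc f` of the zero matrix is `f 0 • 1`. [folklore] -/
theorem cfc_zero_matrix (f : ℝ → ℝ) : cfc f (0 : Matrix ι ι ℂ) = algebraMap ℝ (Matrix ι ι ℂ) (f 0) := by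
  rw [show (0 : Matrix ι ι ℂ) = algebraMap ℝ (Matrix ι ι ℂ) 0 by simp, cfc_algebraMap 0 f]

/-- Real multiples of the identity, as complex block entries. [folklore] -/
theorem isHermitian_real_smul_one (r : ℝ) : ((r : ℂ) • (1 : Matrix ι ι ℂ)).IsHermitian := by
  rw [← real_smul_eq_coe_smul]
  exact (IsSelfAdjoint.smul (IsSelfAdjoint.all r) (IsSelfAdjoint.one (Matrix ι ι ℂ)) : IsSelfAdjoint _)

/-- **Jensen's inequality for projections implies matrix convexity** (Hansen–Pedersen 1982;
Hiai–Petz, *Introduction to Matrix Analysis*, Thm 4.23, second statement): if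
`f(P X P) ≤ P f(X) P` for all Hermitian `X` with spectrum in `Δ` and all orthogonal projections `P`
(the spectrum of `PXP` lying in `Δ`), then `f` is matrix convex on `Δ`. Proof: `C = A ⊕ B`, the
rotation `U = [[√c, -√(1-c)], [√(1-c), √c]]`, `P = 1 ⊕ 0`: `P U⋆CU P = (cA + (1-c)B) ⊕ 0`.
[folklore] -/
theorem isMatrixConvexOn_of_proj_jensen {f : ℝ → ℝ} {Δ : Set ℝ} (hΔ0 : (0 : ℝ) ∈ Δ)
    (hJ : ∀ {κ : Type} [Fintype κ] [DecidableEq κ] (X P : Matrix κ κ ℂ), X.IsHermitian →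
      spectrum ℝ X ⊆ Δ → P.IsHermitian → P * P = P → spectrum ℝ (P * X * P) ⊆ Δ →
      (P * cfc f X * P - cfc f (P * X * P)).PosSemidef) :
    IsMatrixConvexOn f Δ := by
  intro n A B hA hB hAs hBs c hc0 hc1 hCs
  -- data on `Fin n ⊕ Fin n`
  set s : ℝ := Real.sqrt c with hs
  set r : ℝ := Real.sqrt (1 - c) with hr
  have hs2 : s * s = c := Real.mul_self_sqrt hc0
  have hr2 : r * r = 1 - c := Real.mul_self_sqrt (sub_nonneg.mpr hc1)
  set I : Matrix (Fin n) (Fin n) ℂ := 1 with hI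
  set U : Matrix (Fin n ⊕ Fin n) (Fin n ⊕ Fin n) ℂ :=
    Matrix.fromBlocks ((s : ℂ) • I) (-((r : ℂ) • I)) ((r : ℂ) • I) ((s : ℂ) • I) with hU
  set C : Matrix (Fin n ⊕ Fin n) (Fin n ⊕ Fin n) ℂ := Matrix.fromBlocks A 0 0 B with hC
  set P : Matrix (Fin n ⊕ Fin n) (Fin n ⊕ Fin n) ℂ := Matrix.fromBlocks I 0 0 0 with hP
  have hstarU : star U = Matrix.fromBlocks ((s : ℂ) • I) ((r : ℂ) • I) (-((r : ℂ) • I)) ((s : ℂ) • I) := by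
    rw [hU, Matrix.star_eq_conjTranspose, Matrix.fromBlocks_conjTranspose]
    have h1 : ((s : ℂ) • I)ᴴ = (s : ℂ) • I := (isHermitian_real_smul_one s).eq
    have h2 : ((r : ℂ) • I)ᴴ = (r : ℂ) • I := (isHermitian_real_smul_one r).eq
    rw [Matrix.conjTranspose_neg, h1, h2]
  have hUu : star U * U = 1 := by
    rw [hstarU, hU, Matrix.fromBlocks_multiply, ← Matrix.fromBlocks_one]
    have e11 : (s : ℂ) • I * ((s : ℂ) • I) + (r : ℂ) • I * ((r : ℂ) • I) = 1 := by
      rw [hI]; simp only [smul_mul_smul, Matrix.mul_one, ← add_smul]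
      norm_cast; rw [hs2, hr2]; simp
    have e22 : -((r : ℂ) • I) * -((r : ℂ) • I) + (s : ℂ) • I * ((s : ℂ) • I) = 1 := by
      rw [hI]; simp only [neg_mul_neg, smul_mul_smul, Matrix.mul_one, ← add_smul]
      norm_cast; rw [hs2, hr2]; simp
    have e12 : (s : ℂ) • I * -((r : ℂ) • I) + (r : ℂ) • I * ((s : ℂ) • I) = 0 := by
      rw [hI]; simp only [mul_neg, smul_mul_smul, Matrix.mul_one]; rw [mul_comm]; simp
    have e21 : -((r : ℂ) • I) * ((s : ℂ) • I) + (s : ℂ) • I * ((r : ℂ) • I) = 0 := by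
      rw [hI]; simp only [neg_mul, smul_mul_smul, Matrix.mul_one]; rw [mul_comm]; simp
    rw [e11, e12, e21, e22]
  have hCh : C.IsHermitian := Matrix.IsHermitian.fromBlocks hA (by simp) hB
  have hPh : P.IsHermitian := Matrix.IsHermitian.fromBlocks Matrix.isHermitian_one (by simp) (by simp)
  have hPP : P * P = P := by rw [hP, Matrix.fromBlocks_multiply]; simp [hI]
  set X := star U * C * U with hX
  have hXh : X.IsHermitian := Matrix.isHermitian_conjTranspose_mul_mul U hCh
  have hspecX : spectrum ℝ X ⊆ Δ := by
    rw [hX, spectrum_real_unitary_conj hUu, hC, spectrum_real_fromBlocks_diag]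
    exact Set.union_subset hAs hBs
  -- the compression
  set M : Matrix (Fin n) (Fin n) ℂ := (c : ℂ) • A + ((1 - c : ℝ) : ℂ) • B with hM
  have hPXP : P * X * P = Matrix.fromBlocks M 0 0 0 := by
    rw [hX, hstarU, hC, hU, hP]
    simp only [Matrix.fromBlocks_multiply, Matrix.mul_zero, Matrix.zero_mul, add_zero, zero_add,
      Matrix.mul_one, Matrix.one_mul, hI, smul_mul_smul, Matrix.smul_mul, Matrix.mul_smul, mul_neg,
      neg_mul, neg_neg, hM]
    congr 1
    rw [← Complex.ofReal_mul, ← Complex.ofReal_mul, hs2, hr2]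
  have hspecPXP : spectrum ℝ (P * X * P) ⊆ Δ := by
    rw [hPXP, spectrum_real_fromBlocks_diag]
    refine Set.union_subset hCs ?_
    -- spectrum of the zero block
    intro x hx
    rcases isEmpty_or_nonempty (Fin n) with hn | hn
    · exfalso
      exact spectrum.mem_iff.mp hx (isUnit_of_subsingleton _)
    · rw [mem_spectrum_real_iff_det, sub_zero, Matrix.det_smul, Matrix.det_one, mul_one] at hx
      have hx0 : (x : ℂ) = 0 := (pow_eq_zero_iff Fintype.card_ne_zero).mp hx
      have : x = 0 := by exact_mod_cast hx0
      rw [this]; exact hΔ0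
  -- Jensen
  have key := hJ X P hXh hspecX hPh hPP hspecPXP
  -- compute both sides
  have hfX : cfc f X = star U * Matrix.fromBlocks (cfc f A) 0 0 (cfc f B) * U := by
    rw [hX, cfc_unitary_conj' hUu hCh, hC, cfc_fromBlocks_diag' hA hB]
  have hMh : M.IsHermitian := by
    rw [hM]
    refine Matrix.IsHermitian.add ?_ ?_
    · rw [← real_smul_eq_coe_smul]
      exact (IsSelfAdjoint.smul (IsSelfAdjoint.all c) (hA : IsSelfAdjoint _) : IsSelfAdjoint _)
    · rw [← real_smul_eq_coe_smul]
      exact (IsSelfAdjoint.smul (IsSelfAdjoint.all (1 - c)) (hB : IsSelfAdjoint _) : IsSelfAdjoint _)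
  have hfPXP : cfc f (P * X * P) = Matrix.fromBlocks (cfc f M) 0 0 (algebraMap ℝ _ (f 0)) := by
    rw [hPXP, cfc_fromBlocks_diag' hMh Matrix.isHermitian_zero, cfc_zero_matrix]
  have hPfXP : P * cfc f X * P =
      Matrix.fromBlocks ((c : ℂ) • cfc f A + ((1 - c : ℝ) : ℂ) • cfc f B) 0 0 0 := by
    rw [hfX, hstarU, hU, hP]
    simp only [Matrix.fromBlocks_multiply, Matrix.mul_zero, Matrix.zero_mul, add_zero, zero_add,
      Matrix.mul_one, Matrix.one_mul, hI, smul_mul_smul, Matrix.smul_mul, Matrix.mul_smul, mul_neg,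
      neg_mul, neg_neg]
    congr 1
    rw [← Complex.ofReal_mul, ← Complex.ofReal_mul, hs2, hr2]
  rw [hPfXP, hfPXP] at key
  -- extract the (1,1) block
  have hsub := key.submatrix (Sum.inl : Fin n → Fin n ⊕ Fin n)
  have : (Matrix.fromBlocks ((c : ℂ) • cfc f A + ((1 - c : ℝ) : ℂ) • cfc f B) 0 0 0 -
      Matrix.fromBlocks (cfc f M) 0 0 (algebraMap ℝ (Matrix (Fin n) (Fin n) ℂ) (f 0))).submatrix Sum.inl Sum.inl =
      (c : ℂ) • cfc f A + ((1 - c : ℝ) : ℂ) • cfc f B - cfc f M := by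
    ext i j; simp
  rw [this] at hsub
  exact hsub

end Jensen2

end Literature.Analysis.Complex

namespace Literature.Analysis.Complex

open scoped ComplexOrder MatrixOrder Matrix.Norms.L2Operator
open Set Filter Topology Polynomial

section Example424

variable {κ : Type*} [Fintype κ] [DecidableEq κ]

/-- `(T T⋆)^k T = T (T⋆ T)^k`. [folklore] -/
theorem mul_star_pow_mul (T : Matrix κ κ ℂ) (k : ℕ) : (T * star T) ^ k * T = T * (star T * T) ^ k := by
  induction k with
  | zero => simp
  | succ k ih =>
    rw [pow_succ, Matrix.mul_assoc, show T * star T * T = T * (star T * T) by simp only [Matrix.mul_assoc],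
      ← Matrix.mul_assoc, ih, Matrix.mul_assoc, ← pow_succ]

/-- **Intertwining** `h(T T⋆) T = T h(T⋆ T)` for the functional calculus of matrices. [folklore] -/
theorem cfc_mul_star_mul_eq (T : Matrix κ κ ℂ) (h : ℝ → ℝ) :
    cfc h (T * star T) * T = T * cfc h (star T * T) := by
  have h1 : (T * star T).IsHermitian := by
    simpa [Matrix.star_eq_conjTranspose] using Matrix.isHermitian_mul_conjTranspose_self T
  have h2 : (star T * T).IsHermitian := by
    simpa [Matrix.star_eq_conjTranspose] using Matrix.isHermitian_conjTranspose_mul_self T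
  obtain ⟨q, hq⟩ := exists_polynomial_eqOn_of_finite
    ((Matrix.finite_real_spectrum (A := T * star T)).union (Matrix.finite_real_spectrum (A := star T * T))) h
  rw [cfc_congr (hq.mono Set.subset_union_left), cfc_congr (hq.mono Set.subset_union_right)]
  erw [cfc_polynomial q _ (h1 : IsSelfAdjoint _), cfc_polynomial q _ (h2 : IsSelfAdjoint _)]
  simp only [aeval_eq_sum_range, real_smul_eq_coe_smul, Finset.sum_mul, Finset.mul_sum, Matrix.smul_mul,
    Matrix.mul_smul, mul_star_pow_mul]

/-- The square root of a positive semidefinite matrix through `cfc`. [folklore] -/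
theorem cfc_sqrt_mul_self' {X : Matrix κ κ ℂ} (hX : X.IsHermitian) (hXs : ∀ x ∈ spectrum ℝ X, 0 ≤ x) :
    cfc Real.sqrt X * cfc Real.sqrt X = X := by
  have hX' : IsSelfAdjoint X := hX
  have hc : ∀ φ : ℝ → ℝ, ContinuousOn φ (spectrum ℝ X) := fun φ =>
    (Matrix.finite_real_spectrum (A := X)).continuousOn φ
  rw [← cfc_mul _ _ X (hc _) (hc _)]
  conv_rhs => rw [← cfc_id' ℝ X]
  exact cfc_congr fun x hx => Real.mul_self_sqrt (hXs x hx)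

/-- **Hansen–Pedersen / Hiai–Petz Example 4.24 (second half)**: if `g` is matrix monotone on
`[0, b)`, then `f(x) = x g(x)` satisfies Jensen's inequality for projections,
`f(P X P) ≤ P f(X) P` for `X` Hermitian with spectrum in `[0,b)`. Proof: with `R = X^{1/2}` and
`T = R P` one has `T⋆T = PXP`, `TT⋆ = RPR ≤ X`, so `g(RPR) ≤ g(X)`; conjugating by `PR` and using
`g(TT⋆)T = T g(T⋆T)` gives the claim. [folklore] -/
theorem proj_jensen_of_isMatrixMonotoneOn {g : ℝ → ℝ} {b : ℝ} (hg : IsMatrixMonotoneOn g (Set.Ico 0 b))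
    (X P : Matrix κ κ ℂ) (hX : X.IsHermitian) (hXs : spectrum ℝ X ⊆ Set.Ico 0 b)
    (hP : P.IsHermitian) (hPP : P * P = P) (_hPXP : spectrum ℝ (P * X * P) ⊆ Set.Ico 0 b) :
    (P * cfc (fun x => x * g x) X * P - cfc (fun x => x * g x) (P * X * P)).PosSemidef := by
  rcases isEmpty_or_nonempty κ with hκ | hκ
  · exact ⟨Matrix.IsHermitian.ext fun i => (IsEmpty.false i).elim, fun x => by
      simp [Finsupp.sum, Finset.eq_empty_of_isEmpty]⟩
  have hX' : IsSelfAdjoint X := hX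
  have hc : ∀ (φ : ℝ → ℝ) (Y : Matrix κ κ ℂ), ContinuousOn φ (spectrum ℝ Y) := fun φ Y =>
    (Matrix.finite_real_spectrum (A := Y)).continuousOn φ
  -- an upper bound `β < b` for the spectrum of `X`
  have hfin := Matrix.finite_real_spectrum (A := X)
  have hne : hfin.toFinset.Nonempty := by
    obtain ⟨i⟩ := hκ
    exact ⟨_, hfin.mem_toFinset.mpr (hX.eigenvalues_mem_spectrum_real i)⟩
  set β : ℝ := hfin.toFinset.max' hne with hβ
  have hβmem : β ∈ spectrum ℝ X := hfin.mem_toFinset.mp (hfin.toFinset.max'_mem hne)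
  have hβb : β < b := (hXs hβmem).2
  have hβ0 : 0 ≤ β := (hXs hβmem).1
  have hXβ : spectrum ℝ X ⊆ Set.Icc 0 β := fun x hx =>
    ⟨(hXs hx).1, hfin.toFinset.le_max' x (hfin.mem_toFinset.mpr hx)⟩
  obtain ⟨hX0, hXle⟩ := le_and_le_of_spectrum_subset hX hXβ
  rw [map_zero, sub_zero] at hX0
  -- the square root
  set R := cfc Real.sqrt X with hR
  have hRh : R.IsHermitian := (cfc_predicate Real.sqrt X : IsSelfAdjoint _)
  have hRR : R * R = X := cfc_sqrt_mul_self' hX fun x hx => (hXs hx).1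
  have hstarR : star R = R := hRh
  have hstarP : star P = P := hP
  -- `T = R P`
  set T := R * P with hT
  have hTT : star T * T = P * X * P := by
    rw [hT, star_mul, hstarR, hstarP, Matrix.mul_assoc, ← Matrix.mul_assoc R R, hRR, ← Matrix.mul_assoc]
  have hTT' : T * star T = R * P * R := by
    rw [hT, star_mul, hstarR, hstarP, Matrix.mul_assoc, ← Matrix.mul_assoc P P, hPP, ← Matrix.mul_assoc]
  -- `RPR ≤ X`
  have hRPRle : (X - R * P * R).PosSemidef := by
    have : X - R * P * R = ((1 - P) * R)ᴴ * ((1 - P) * R) := by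
      rw [Matrix.conjTranspose_mul, hRh.eq, Matrix.conjTranspose_sub, Matrix.conjTranspose_one, hP.eq]
      rw [show R * (1 - P) * ((1 - P) * R) = R * ((1 - P) * (1 - P)) * R by simp only [Matrix.mul_assoc]]
      have h1P : (1 - P) * (1 - P) = 1 - P := by
        rw [Matrix.sub_mul, Matrix.mul_sub, Matrix.mul_sub, Matrix.one_mul, Matrix.mul_one, Matrix.one_mul,
          hPP]; abel
      rw [h1P, Matrix.mul_sub, Matrix.sub_mul, Matrix.mul_one, hRR]
    rw [this]
    exact Matrix.posSemidef_conjTranspose_mul_self _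
  have hRPRh : (R * P * R).IsHermitian := by
    have := Matrix.isHermitian_conjTranspose_mul_mul R hP
    rwa [hRh.eq] at this
  have hRPR0 : (R * P * R).PosSemidef := by
    have : R * P * R = (P * R)ᴴ * (P * R) := by
      rw [Matrix.conjTranspose_mul, hRh.eq, hP.eq, ← Matrix.mul_assoc, Matrix.mul_assoc R P P, hPP]
    rw [this]; exact Matrix.posSemidef_conjTranspose_mul_self _
  have hRPRs : spectrum ℝ (R * P * R) ⊆ Set.Ico 0 b := by
    have hup : (algebraMap ℝ (Matrix κ κ ℂ) β - R * P * R).PosSemidef := by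
      have : algebraMap ℝ (Matrix κ κ ℂ) β - R * P * R = (algebraMap ℝ _ β - X) + (X - R * P * R) := by abel
      rw [this]; exact hXle.add hRPRle
    have hlo : (R * P * R - algebraMap ℝ (Matrix κ κ ℂ) 0).PosSemidef := by
      rw [map_zero, sub_zero]; exact hRPR0
    intro x hx
    have := spectrum_subset_Icc_of_le_of_le hRPRh hlo hup hx
    exact ⟨this.1, this.2.trans_lt hβb⟩
  -- monotonicity
  have hmono := hg.posSemidef_of_fintype hRPRh hX hRPRs hXs hRPRle
  -- conjugate by `N = P R`
  have hconj := hmono.mul_mul_conjTranspose_same (P * R)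
  have hN : (P * R)ᴴ = R * P := by rw [Matrix.conjTranspose_mul, hRh.eq, hP.eq]
  rw [hN, Matrix.mul_sub, Matrix.sub_mul] at hconj
  -- identify the two terms
  have hcomm : R * cfc g X = cfc g X * R := by
    rw [hR, ← cfc_mul _ _ X (hc _ X) (hc _ X), ← cfc_mul _ _ X (hc _ X) (hc _ X)]
    exact cfc_congr fun x _ => mul_comm _ _
  have hfX : cfc (fun x => x * g x) X = X * cfc g X := by
    rw [cfc_mul _ _ X (hc _ X) (hc _ X), cfc_id' ℝ X]
  have hPXPh : (P * X * P).IsHermitian := by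
    have := Matrix.isHermitian_conjTranspose_mul_mul P hX; rwa [hP.eq] at this
  have hfPXP : cfc (fun x => x * g x) (P * X * P) = P * X * P * cfc g (P * X * P) := by
    rw [cfc_mul _ _ (P * X * P) (hc _ _) (hc _ _)]
    erw [cfc_id' ℝ (P * X * P) (hPXPh : IsSelfAdjoint _)]
  have hcomm2 : X * cfc g X = cfc g X * X := by
    have h := (cfc_commute_cfc (fun x : ℝ => x) g X).eq
    rwa [cfc_id' ℝ X hX'] at h
  have hterm1 : P * R * cfc g X * (R * P) = P * cfc (fun x => x * g x) X * P := by
    calc P * R * cfc g X * (R * P) = P * (R * cfc g X * R) * P := by simp only [Matrix.mul_assoc]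
      _ = P * (cfc g X * (R * R)) * P := by rw [hcomm, Matrix.mul_assoc (cfc g X) R R]
      _ = P * cfc (fun x => x * g x) X * P := by rw [hRR, hfX, hcomm2]
  have hterm2 : P * R * cfc g (R * P * R) * (R * P) = cfc (fun x => x * g x) (P * X * P) := by
    rw [hfPXP, ← hTT', show R * P = T from rfl, Matrix.mul_assoc (P * R), cfc_mul_star_mul_eq T g, hTT, hT]
    simp only [← Matrix.mul_assoc]
    rw [Matrix.mul_assoc P R R, hRR]
  rw [hterm1, hterm2] at hconj
  exact hconj

end Example424

end Literature.Analysis.Complex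

namespace Literature.Analysis.Complex

open scoped ComplexOrder MatrixOrder Matrix.Norms.L2Operator
open Set Filter Topology Polynomial

section ConvexAPI2

variable {f g : ℝ → ℝ} {Δ Δ' : Set ℝ}

/-- Auxiliary for the proof of Loewner's theorem (`IsMatrixConvexOn.mono`: mono). [folklore] -/
theorem IsMatrixConvexOn.mono (h : IsMatrixConvexOn f Δ) (hΔ : Δ' ⊆ Δ) : IsMatrixConvexOn f Δ' :=
  fun n A B hA hB hAs hBs c hc0 hc1 hCs =>
    h n A B hA hB (hAs.trans hΔ) (hBs.trans hΔ) c hc0 hc1 (hCs.trans hΔ)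

/-- Auxiliary for the proof of Loewner's theorem (`IsMatrixConvexOn.congr`: congr). [folklore] -/
theorem IsMatrixConvexOn.congr (h : IsMatrixConvexOn f Δ) (hfg : Δ.EqOn f g) : IsMatrixConvexOn g Δ := by
  intro n A B hA hB hAs hBs c hc0 hc1 hCs
  rw [← cfc_congr fun x hx => hfg (hAs hx), ← cfc_congr fun x hx => hfg (hBs hx),
    ← cfc_congr fun x hx => hfg (hCs hx)]
  exact h n A B hA hB hAs hBs c hc0 hc1 hCs

/-- Nonnegative combinations of matrix convex functions are matrix convex. [folklore] -/
theorem IsMatrixConvexOn.add_nonneg (hf : IsMatrixConvexOn f Δ) (hg : IsMatrixConvexOn g Δ) {a b : ℝ}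
    (ha : 0 ≤ a) (hb : 0 ≤ b) : IsMatrixConvexOn (fun x => a * f x + b * g x) Δ := by
  intro n A B hA hB hAs hBs c hc0 hc1 hCs
  have hcon : ∀ (φ : ℝ → ℝ) (E : Matrix (Fin n) (Fin n) ℂ), ContinuousOn φ (spectrum ℝ E) :=
    fun φ E => (Matrix.finite_real_spectrum (A := E)).continuousOn φ
  have hexp : ∀ E : Matrix (Fin n) (Fin n) ℂ, cfc (fun x => a * f x + b * g x) E = a • cfc f E + b • cfc g E := by
    intro E
    rw [cfc_add E _ _ (hcon _ E) (hcon _ E), cfc_const_mul a f E (hcon _ E), cfc_const_mul b g E (hcon _ E)]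
  rw [hexp, hexp, hexp]
  have h1 := hf n A B hA hB hAs hBs c hc0 hc1 hCs
  have h2 := hg n A B hA hB hAs hBs c hc0 hc1 hCs
  have : (c : ℂ) • (a • cfc f A + b • cfc g A) + ((1 - c : ℝ) : ℂ) • (a • cfc f B + b • cfc g B) -
      (a • cfc f ((c : ℂ) • A + ((1 - c : ℝ) : ℂ) • B) + b • cfc g ((c : ℂ) • A + ((1 - c : ℝ) : ℂ) • B)) =
      a • ((c : ℂ) • cfc f A + ((1 - c : ℝ) : ℂ) • cfc f B - cfc f ((c : ℂ) • A + ((1 - c : ℝ) : ℂ) • B)) +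
      b • ((c : ℂ) • cfc g A + ((1 - c : ℝ) : ℂ) • cfc g B - cfc g ((c : ℂ) • A + ((1 - c : ℝ) : ℂ) • B)) := by
    simp only [real_smul_eq_coe_smul]; module
  rw [this]
  exact (h1.smul ha).add (h2.smul hb)

/-- **Affine change of variable** for matrix convexity (`a ≠ 0` allowed to be negative). [folklore] -/
theorem IsMatrixConvexOn.comp_affine (h : IsMatrixConvexOn f Δ) (a b : ℝ) :
    IsMatrixConvexOn (fun x => f (a * x + b)) ((fun x => a * x + b) ⁻¹' Δ) := by
  intro n A B hA hB hAs hBs c hc0 hc1 hCs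
  have hcon : ∀ (φ : ℝ → ℝ) (S : Set ℝ), S.Finite → ContinuousOn φ S := fun φ S hS => hS.continuousOn φ
  have htr : ∀ (E : Matrix (Fin n) (Fin n) ℂ), E.IsHermitian → spectrum ℝ E ⊆ (fun x => a * x + b) ⁻¹' Δ →
      cfc (fun x => f (a * x + b)) E = cfc f (cfc (fun x => a * x + b) E) ∧
        (cfc (fun x => a * x + b) E).IsHermitian ∧ spectrum ℝ (cfc (fun x => a * x + b) E) ⊆ Δ ∧
        cfc (fun x => a * x + b) E = a • E + algebraMap ℝ _ b := by
    intro E hE hEs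
    have hE' : IsSelfAdjoint E := hE
    refine ⟨?_, ?_, ?_, ?_⟩
    · rw [cfc_comp' f (fun x => a * x + b) E
        (hcon _ _ ((Matrix.finite_real_spectrum (A := E)).image _))
        (hcon _ _ (Matrix.finite_real_spectrum (A := E)))]
    · exact (cfc_predicate (fun x => a * x + b) E : IsSelfAdjoint _)
    · rw [cfc_map_spectrum (f := fun x => a * x + b) (a := E) hE'
        (hcon _ _ (Matrix.finite_real_spectrum (A := E)))]
      rintro _ ⟨x, hx, rfl⟩
      exact hEs hx
    · rw [cfc_add E _ _ (hcon _ _ (Matrix.finite_real_spectrum (A := E)))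
        (hcon _ _ (Matrix.finite_real_spectrum (A := E))), cfc_const_mul_id a E, cfc_const b E]
  have hC : ((c : ℂ) • A + ((1 - c : ℝ) : ℂ) • B).IsHermitian := by
    refine Matrix.IsHermitian.add ?_ ?_
    · rw [← real_smul_eq_coe_smul]
      exact (IsSelfAdjoint.smul (IsSelfAdjoint.all c) (hA : IsSelfAdjoint _) : IsSelfAdjoint _)
    · rw [← real_smul_eq_coe_smul]
      exact (IsSelfAdjoint.smul (IsSelfAdjoint.all (1 - c)) (hB : IsSelfAdjoint _) : IsSelfAdjoint _)
  obtain ⟨eA, hA2, hA3, hA4⟩ := htr A hA hAs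
  obtain ⟨eB, hB2, hB3, hB4⟩ := htr B hB hBs
  obtain ⟨eC, hC2, hC3, hC4⟩ := htr _ hC hCs
  rw [eA, eB, eC]
  have hcomb : cfc (fun x => a * x + b) ((c : ℂ) • A + ((1 - c : ℝ) : ℂ) • B) =
      (c : ℂ) • cfc (fun x => a * x + b) A + ((1 - c : ℝ) : ℂ) • cfc (fun x => a * x + b) B := by
    rw [hA4, hB4, hC4]
    simp only [Algebra.algebraMap_eq_smul_one, real_smul_eq_coe_smul]
    push_cast
    module
  rw [hcomb]
  refine h n _ _ hA2 hB2 hA3 hB3 c hc0 hc1 ?_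
  rw [← hcomb]; exact hC3

/-- The quadratic form of `cfc F A` through the eigen-decomposition. [folklore] -/
theorem qform_cfc {ι : Type*} [Fintype ι] [DecidableEq ι] {A : Matrix ι ι ℂ} (hA : A.IsHermitian)
    (F : ℝ → ℝ) (v : ι → ℂ) :
    qform (cfc F A) v = ∑ i, F (hA.eigenvalues i) *
      Complex.normSq ((star (hA.eigenvectorUnitary : Matrix ι ι ℂ) *ᵥ v) i) := by
  -- reindex-free proof: repeat the computation of `star_dotProduct_cfc_mulVec`
  unfold qform
  rw [hA.cfc_eq, Matrix.IsHermitian.cfc, Unitary.conjStarAlgAut_apply]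
  set U : Matrix ι ι ℂ := (hA.eigenvectorUnitary : Matrix ι ι ℂ) with hU
  set w := star U *ᵥ v with hw
  rw [← Matrix.mulVec_mulVec, ← Matrix.mulVec_mulVec, Matrix.dotProduct_mulVec]
  have hsv : star v ᵥ* U = star w := by
    rw [hw, Matrix.star_mulVec, Matrix.star_eq_conjTranspose, Matrix.conjTranspose_conjTranspose]
  rw [hsv, ← hw]
  simp only [dotProduct, Matrix.mulVec_diagonal, Function.comp_apply, Pi.star_apply, Complex.re_sum]
  refine Finset.sum_congr rfl fun i _ => ?_
  have hc : (RCLike.ofReal (F (hA.eigenvalues i)) : ℂ) = ((F (hA.eigenvalues i) : ℝ) : ℂ) := rfl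
  rw [hc, show star (w i) * ((F (hA.eigenvalues i) : ℝ) * w i) =
    (F (hA.eigenvalues i) : ℂ) * (Complex.normSq (w i) : ℂ) by
      rw [Complex.normSq_eq_conj_mul_self]; simp only [RCLike.star_def]; ring]
  norm_cast

/-- Matrix convexity from eventual convexity of approximants on growing domains. [folklore] -/
theorem IsMatrixConvexOn.of_eventually {α : Type*} {l : Filter α} [l.NeBot] {F : α → ℝ → ℝ}
    {D : α → Set ℝ} (hF : ∀ᶠ k in l, IsMatrixConvexOn (F k) (D k))
    (hD : ∀ S : Set ℝ, S.Finite → S ⊆ Δ → ∀ᶠ k in l, S ⊆ D k)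
    (hlim : ∀ x ∈ Δ, Tendsto (fun k => F k x) l (𝓝 (f x))) : IsMatrixConvexOn f Δ := by
  intro n A B hA hB hAs hBs c hc0 hc1 hCs
  set C := (c : ℂ) • A + ((1 - c : ℝ) : ℂ) • B with hCdef
  have hC : C.IsHermitian := by
    refine Matrix.IsHermitian.add ?_ ?_
    · rw [← real_smul_eq_coe_smul]
      exact (IsSelfAdjoint.smul (IsSelfAdjoint.all c) (hA : IsSelfAdjoint _) : IsSelfAdjoint _)
    · rw [← real_smul_eq_coe_smul]
      exact (IsSelfAdjoint.smul (IsSelfAdjoint.all (1 - c)) (hB : IsSelfAdjoint _) : IsSelfAdjoint _)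
  have hS : (spectrum ℝ A ∪ spectrum ℝ B ∪ spectrum ℝ C) ⊆ Δ :=
    Set.union_subset (Set.union_subset hAs hBs) hCs
  have hev := hD _ (((Matrix.finite_real_spectrum (A := A)).union
    (Matrix.finite_real_spectrum (A := B))).union (Matrix.finite_real_spectrum (A := C))) hS
  -- Hermitian target
  have hherm : ∀ φ : ℝ → ℝ, ((c : ℂ) • cfc φ A + ((1 - c : ℝ) : ℂ) • cfc φ B - cfc φ C).IsHermitian := by
    intro φ
    refine Matrix.IsHermitian.sub (Matrix.IsHermitian.add ?_ ?_) (cfc_predicate φ C : IsSelfAdjoint _)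
    · rw [← real_smul_eq_coe_smul]
      exact (IsSelfAdjoint.smul (IsSelfAdjoint.all c) (cfc_predicate φ A : IsSelfAdjoint _) : IsSelfAdjoint _)
    · rw [← real_smul_eq_coe_smul]
      exact (IsSelfAdjoint.smul (IsSelfAdjoint.all (1 - c)) (cfc_predicate φ B : IsSelfAdjoint _) :
        IsSelfAdjoint _)
  rw [posSemidef_iff_qform (hherm f)]
  intro w
  have hq : ∀ φ : ℝ → ℝ, qform ((c : ℂ) • cfc φ A + ((1 - c : ℝ) : ℂ) • cfc φ B - cfc φ C) w =
      c * qform (cfc φ A) w + (1 - c) * qform (cfc φ B) w - qform (cfc φ C) w := by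
    intro φ; rw [qform_sub, qform_add, qform_smul, qform_smul]
  rw [hq]
  have hlimq : ∀ {E : Matrix (Fin n) (Fin n) ℂ} (hE : E.IsHermitian), spectrum ℝ E ⊆ Δ →
      Tendsto (fun k => qform (cfc (F k) E) w) l (𝓝 (qform (cfc f E) w)) := by
    intro E hE hEs
    simp only [qform_cfc hE]
    exact tendsto_finsetSum _ fun i _ => (hlim _ (hEs (hE.eigenvalues_mem_spectrum_real i))).mul_const _
  have hT := ((hlimq hA hAs).const_mul c).add ((hlimq hB hBs).const_mul (1 - c)) |>.sub (hlimq hC hCs)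
  refine ge_of_tendsto hT ?_
  filter_upwards [hev, hF] with k hk hFk
  have hk' := hFk n A B hA hB (Set.subset_union_left.trans (Set.subset_union_left.trans hk))
    (Set.subset_union_right.trans (Set.subset_union_left.trans hk)) c hc0 hc1
    (Set.subset_union_right.trans hk)
  have := qform_nonneg_of_posSemidef hk' w
  rw [hq] at this
  exact this

end ConvexAPI2

end Literature.Analysis.Complex

namespace Literature.Analysis.Complex

open scoped ComplexOrder MatrixOrder Matrix.Norms.L2Operator
open Set Filter Topology Polynomial

section Lemma434

/-- **Hansen–Pedersen / Hiai–Petz Lemma 4.34 (1), first half**: if `f` is matrix monotone on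
`(-1,1)` then `(x+1) f(x)` is matrix convex on `(-1,1)`. Proof: for `0 < ε < 1`,
`f(x - 1 + ε)` is matrix monotone on `[0, 2-ε)`, so `x f(x-1+ε)` is matrix convex there
(Example 4.24 + Theorem 4.23); translate back and let `ε ↘ 0`. [folklore] -/
theorem isMatrixConvexOn_add_one_mul {f : ℝ → ℝ} (hf : IsMatrixMonotoneOn f (Set.Ioo (-1) 1)) :
    IsMatrixConvexOn (fun x => (x + 1) * f x) (Set.Ioo (-1) 1) := by
  refine IsMatrixConvexOn.of_eventually (l := 𝓝[>] (0 : ℝ)) (F := fun ε y => (y + 1 - ε) * f y)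
    (D := fun ε => Set.Ico (-1 + ε) 1) ?_ ?_ ?_
  · -- convexity of the approximants
    filter_upwards [Ioo_mem_nhdsGT (show (0 : ℝ) < 1 from one_pos)] with ε hε
    -- `F(x) = f(x - 1 + ε)` is matrix monotone on `[0, 2 - ε)`
    have hF : IsMatrixMonotoneOn (fun x => f (1 * x + (-1 + ε))) (Set.Ico 0 (2 - ε)) := by
      refine (hf.comp_affine one_pos (b := -1 + ε)).mono ?_
      intro x hx
      simp only [Set.mem_preimage, Set.mem_Ioo, one_mul]
      constructor <;> linarith [hx.1, hx.2, hε.1, hε.2]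
    -- `x F(x)` is matrix convex on `[0, 2 - ε)`
    have hG : IsMatrixConvexOn (fun x => x * f (1 * x + (-1 + ε))) (Set.Ico 0 (2 - ε)) :=
      isMatrixConvexOn_of_proj_jensen (Δ := Set.Ico 0 (2 - ε)) ⟨le_rfl, by linarith [hε.2]⟩
        (fun X P hX hXs hP hPP hPXP => proj_jensen_of_isMatrixMonotoneOn hF X P hX hXs hP hPP hPXP)
    -- translate back
    have hT := hG.comp_affine 1 (1 - ε)
    refine (hT.mono ?_).congr ?_
    · intro y hy
      simp only [Set.mem_preimage, Set.mem_Ico, one_mul]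
      constructor <;> linarith [hy.1, hy.2]
    · intro y _
      simp only
      rw [show (1 : ℝ) * (1 * y + (1 - ε)) + (-1 + ε) = y by ring]
      ring
  · -- growing domains
    intro S hS hSΔ
    have : ∀ x ∈ S, ∀ᶠ (k : ℝ) in 𝓝[>] 0, x ∈ Set.Ico (-1 + k) 1 := by
      intro x hx
      have hx' := hSΔ hx
      filter_upwards [Ioo_mem_nhdsGT (show (0 : ℝ) < x + 1 by linarith [hx'.1])] with k hk
      exact ⟨by linarith [hk.2], hx'.2⟩
    filter_upwards [(Filter.eventually_all_finite hS).mpr this] with k hk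
    exact fun x hx => hk x hx
  · -- pointwise convergence
    intro y _
    have : Tendsto (fun ε : ℝ => (y + 1 - ε) * f y) (𝓝 0) (𝓝 ((y + 1 - 0) * f y)) := by
      exact ((continuous_const.sub continuous_id).mul continuous_const).tendsto 0
    simpa using this.mono_left nhdsWithin_le_nhds

end Lemma434

end Literature.Analysis.Complex

namespace Literature.Analysis.Complex

open scoped ComplexOrder MatrixOrder Matrix.Norms.L2Operator
open Set Filter Topology Polynomial

section Lemma434b

/-- **Lemma 4.34 (1), second half**: `(x-1) f(x)` is matrix convex on `(-1,1)` (apply the first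
half to `-f(-x)`). [folklore] -/
theorem isMatrixConvexOn_sub_one_mul {f : ℝ → ℝ} (hf : IsMatrixMonotoneOn f (Set.Ioo (-1) 1)) :
    IsMatrixConvexOn (fun x => (x - 1) * f x) (Set.Ioo (-1) 1) := by
  have hneg : IsMatrixMonotoneOn (fun x => -f (-x)) (Set.Ioo (-1) 1) := by
    refine hf.neg_comp_neg.mono ?_
    intro x hx
    simp only [Set.mem_preimage, Set.mem_Ioo]
    constructor <;> linarith [hx.1, hx.2]
  have h1 := isMatrixConvexOn_add_one_mul hneg
  have h2 := h1.comp_affine (-1) 0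
  refine (h2.mono ?_).congr ?_
  · intro x hx
    simp only [Set.mem_preimage, Set.mem_Ioo]
    constructor <;> linarith [hx.1, hx.2]
  · intro x _
    simp only
    rw [show -((-1 : ℝ) * x + 0) = x by ring]
    ring

/-- **Lemma 4.34 (1)**: for `-1 ≤ α ≤ 1`, `(x + α) f(x)` is matrix convex on `(-1,1)`. [folklore] -/
theorem isMatrixConvexOn_add_const_mul {f : ℝ → ℝ} (hf : IsMatrixMonotoneOn f (Set.Ioo (-1) 1))
    {α : ℝ} (hα : α ∈ Set.Icc (-1 : ℝ) 1) :
    IsMatrixConvexOn (fun x => (x + α) * f x) (Set.Ioo (-1) 1) := by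
  have h := (isMatrixConvexOn_add_one_mul hf).add_nonneg (isMatrixConvexOn_sub_one_mul hf)
    (a := (1 + α) / 2) (b := (1 - α) / 2) (by linarith [hα.1]) (by linarith [hα.2])
  refine h.congr fun x _ => ?_
  simp only
  ring

end Lemma434b

end Literature.Analysis.Complex

namespace Literature.Analysis.Complex

open scoped ComplexOrder MatrixOrder Matrix.Norms.L2Operator
open Set Filter Topology Polynomial

section PolyDDAlgebra

/-- Auxiliary for the proof of Loewner's theorem (`polyDD1_add`: polyDD1 add). [folklore] -/
theorem polyDD1_add (p q : ℝ[X]) (x y : ℝ) : polyDD1 (p + q) x y = polyDD1 p x y + polyDD1 q x y := by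
  unfold polyDD1
  exact Polynomial.sum_add_index p q _ (fun i => by simp) (fun a b₁ b₂ => by ring)

/-- Auxiliary for the proof of Loewner's theorem (`polyDD2_add`: polyDD2 add). [folklore] -/
theorem polyDD2_add (p q : ℝ[X]) (x y z : ℝ) :
    polyDD2 (p + q) x y z = polyDD2 p x y z + polyDD2 q x y z := by
  unfold polyDD2
  exact Polynomial.sum_add_index p q _ (fun i => by simp) (fun a b₁ b₂ => by ring)

/-- Auxiliary for the proof of Loewner's theorem (`polyDD1_smul`: polyDD1 smul). [folklore] -/
theorem polyDD1_smul (c : ℝ) (p : ℝ[X]) (x y : ℝ) : polyDD1 (c • p) x y = c * polyDD1 p x y := by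
  unfold polyDD1
  rw [Polynomial.sum_smul_index p c _ (fun i => by simp), Polynomial.sum, Polynomial.sum, Finset.mul_sum]
  exact Finset.sum_congr rfl fun i _ => by ring

/-- Auxiliary for the proof of Loewner's theorem (`polyDD2_smul`: polyDD2 smul). [folklore] -/
theorem polyDD2_smul (c : ℝ) (p : ℝ[X]) (x y z : ℝ) : polyDD2 (c • p) x y z = c * polyDD2 p x y z := by
  unfold polyDD2
  rw [Polynomial.sum_smul_index p c _ (fun i => by simp), Polynomial.sum, Polynomial.sum, Finset.mul_sum]
  exact Finset.sum_congr rfl fun i _ => by ring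

/-- Auxiliary for the proof of Loewner's theorem (`polyDD1_neg`: polyDD1 neg). [folklore] -/
theorem polyDD1_neg (p : ℝ[X]) (x y : ℝ) : polyDD1 (-p) x y = -polyDD1 p x y := by
  rw [show -p = (-1 : ℝ) • p by simp, polyDD1_smul]; ring

/-- Auxiliary for the proof of Loewner's theorem (`polyDD2_neg`: polyDD2 neg). [folklore] -/
theorem polyDD2_neg (p : ℝ[X]) (x y z : ℝ) : polyDD2 (-p) x y z = -polyDD2 p x y z := by
  rw [show -p = (-1 : ℝ) • p by simp, polyDD2_smul]; ring

/-- Auxiliary for the proof of Loewner's theorem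
(`polyDD1_monomial`: polyDD1 monomial). [folklore] -/
theorem polyDD1_monomial (m : ℕ) (c x y : ℝ) : polyDD1 (monomial m c) x y = c * pdd1 m x y := by
  unfold polyDD1; exact Polynomial.sum_monomial_index c _ (by simp)

/-- Auxiliary for the proof of Loewner's theorem
(`polyDD2_monomial`: polyDD2 monomial). [folklore] -/
theorem polyDD2_monomial (m : ℕ) (c x y z : ℝ) : polyDD2 (monomial m c) x y z = c * pdd2 m x y z := by
  unfold polyDD2; exact Polynomial.sum_monomial_index c _ (by simp)

/-- `(X·p)[x, 0, y] = p[x, y]`. [folklore] -/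
theorem polyDD2_X_mul (p : ℝ[X]) (x y : ℝ) : polyDD2 (X * p) x 0 y = polyDD1 p x y := by
  induction p using Polynomial.induction_on' with
  | add p q hp hq => rw [mul_add, polyDD2_add, polyDD1_add, hp, hq]
  | monomial m c =>
    rw [Polynomial.X_mul, Polynomial.monomial_mul_X, polyDD2_monomial, polyDD1_monomial,
      pdd2_succ_zero_mid]

/-- `((X+1)p)[x,0,y] = p[x,y] + p[x,0,y]`. [folklore] -/
theorem polyDD2_X_add_one_mul (p : ℝ[X]) (x y : ℝ) :
    polyDD2 ((X + C 1) * p) x 0 y = polyDD1 p x y + polyDD2 p x 0 y := by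
  rw [add_mul, polyDD2_add, polyDD2_X_mul, C_1, one_mul]

/-- `((X-1)p)[x,0,y] = p[x,y] - p[x,0,y]`. [folklore] -/
theorem polyDD2_X_sub_one_mul (p : ℝ[X]) (x y : ℝ) :
    polyDD2 ((X - C 1) * p) x 0 y = polyDD1 p x y - polyDD2 p x 0 y := by
  rw [sub_mul, sub_eq_add_neg, polyDD2_add, polyDD2_X_mul, C_1, one_mul, polyDD2_neg, ← sub_eq_add_neg]

/-- For `p(0) = 0`: `(p/X)[x,y] = p[x,0,y]`. [folklore] -/
theorem polyDD1_divX {p : ℝ[X]} (hp : p.eval 0 = 0) (x y : ℝ) :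
    polyDD1 (divX p) x y = polyDD2 p x 0 y := by
  have h : X * divX p = p := by
    have := Polynomial.X_mul_divX_add p
    rwa [Polynomial.coeff_zero_eq_eval_zero, hp, C_0, add_zero] at this
  conv_rhs => rw [← h]
  rw [polyDD2_X_mul]

/-- Evaluation of `p/X`. [folklore] -/
theorem eval_divX_mul {p : ℝ[X]} (x : ℝ) : (divX p).eval x * x = p.eval x - p.eval 0 := by
  have := congrArg (Polynomial.eval x) (Polynomial.divX_mul_X_add p)
  rw [eval_add, eval_mul, eval_X, eval_C, Polynomial.coeff_zero_eq_eval_zero] at this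
  linarith

/-- Auxiliary for the proof of Loewner's theorem (`eval_divX_zero`: eval divX zero). [folklore] -/
theorem eval_divX_zero (p : ℝ[X]) : (divX p).eval 0 = p.derivative.eval 0 := by
  rw [← Polynomial.coeff_zero_eq_eval_zero, Polynomial.coeff_divX, ← Polynomial.coeff_zero_eq_eval_zero,
    Polynomial.coeff_derivative]
  simp

/-- Second derivative of `(X + c) p`. [folklore] -/
theorem eval_derivative_derivative_X_add_C_mul (c : ℝ) (p : ℝ[X]) (x : ℝ) :
    ((X + C c) * p).derivative.derivative.eval x =
      2 * p.derivative.eval x + (x + c) * p.derivative.derivative.eval x := by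
  have h1 : derivative ((X + C c) * p) = p + (X + C c) * derivative p := by
    rw [derivative_mul, derivative_add, derivative_X, derivative_C, add_zero, one_mul]
  have h2 : derivative (p + (X + C c) * derivative p) =
      derivative p + (derivative p + (X + C c) * derivative (derivative p)) := by
    rw [derivative_add, derivative_mul, derivative_add, derivative_X, derivative_C, add_zero, one_mul]
  rw [h1, h2]
  simp only [eval_add, eval_mul, eval_X, eval_C]
  ring

/-- Auxiliary for the proof of Loewner's theorem
(`eval_derivative_derivative_X_sub_C_mul`: eval derivative derivative X sub C mul). [folklore] -/
theorem eval_derivative_derivative_X_sub_C_mul (c : ℝ) (p : ℝ[X]) (x : ℝ) :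
    ((X - C c) * p).derivative.derivative.eval x =
      2 * p.derivative.eval x + (x - c) * p.derivative.derivative.eval x := by
  have h1 : derivative ((X - C c) * p) = p + (X - C c) * derivative p := by
    rw [derivative_mul, derivative_sub, derivative_X, derivative_C, sub_zero, one_mul]
  have h2 : derivative (p + (X - C c) * derivative p) =
      derivative p + (derivative p + (X - C c) * derivative (derivative p)) := by
    rw [derivative_add, derivative_mul, derivative_sub, derivative_X, derivative_C, sub_zero, one_mul]
  rw [h1, h2]
  simp only [eval_add, eval_mul, eval_sub, eval_X, eval_C]
  ring

end PolyDDAlgebra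

section QformCfcClose

variable {ι : Type*} [Fintype ι] [DecidableEq ι]

/-- Uniformly close functions have close quadratic forms of their functional calculi. [folklore] -/
theorem abs_qform_cfc_sub_le {A : Matrix ι ι ℂ} (hA : A.IsHermitian) {F G : ℝ → ℝ} {δ : ℝ}
    (h : ∀ x ∈ spectrum ℝ A, |F x - G x| ≤ δ) (w : ι → ℂ) :
    |qform (cfc F A) w - qform (cfc G A) w| ≤ δ * ∑ a, ‖w a‖ ^ 2 := by
  rw [qform_cfc hA F w, qform_cfc hA G w, ← Finset.sum_sub_distrib]
  have hU : (hA.eigenvectorUnitary : Matrix ι ι ℂ) * star (hA.eigenvectorUnitary : Matrix ι ι ℂ) = 1 :=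
    Unitary.coe_mul_star_self hA.eigenvectorUnitary
  rw [← sum_norm_sq_star_mulVec hU w, Finset.mul_sum]
  refine (Finset.abs_sum_le_sum_abs _ _).trans (Finset.sum_le_sum fun i _ => ?_)
  rw [← sub_mul, abs_mul, abs_of_nonneg (Complex.normSq_nonneg _), Complex.normSq_eq_norm_sq]
  exact mul_le_mul_of_nonneg_right (h _ (hA.eigenvalues_mem_spectrum_real i)) (sq_nonneg _)

end QformCfcClose

end Literature.Analysis.Complex

namespace Literature.Analysis.Complex

open scoped ComplexOrder MatrixOrder Matrix.Norms.L2Operator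
open Set Filter Topology Polynomial

section Lemma434c

/-- **Hansen–Pedersen / Hiai–Petz Lemma 4.34 (2)** for `C²` functions: if `f` is matrix monotone
and `C²` on `(-1,1)` with `f(0) = 0`, then for `|α| ≤ 1` the function
`x ↦ (1 + α/x) f(x)` (i.e. `f + α f[·,0]`) is matrix monotone on `(-1,1)`.
Proof (intrinsic, replacing Hiai–Petz's tacit use of Kraus's theorem): by Lemma 4.34 (1) the
functions `(x ± 1) f` are matrix convex; `kraus_qform_ge` bounds the second-divided-difference
matrices `K ± Q` of `C²`-close polynomials from below, hence the Loewner matrix `K + αQ` of the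
polynomial `P + α P/X`; `qform_aeval_sub_aeval_ge` gives approximate monotonicity, and the
approximation errors vanish. [folklore] -/
theorem isMatrixMonotoneOn_add_smul_dd1 {f f' f'' : ℝ → ℝ} (hf : IsMatrixMonotoneOn f (Set.Ioo (-1) 1))
    (hfd : ∀ x ∈ Set.Ioo (-1 : ℝ) 1, HasDerivAt f (f' x) x)
    (hf'd : ∀ x ∈ Set.Ioo (-1 : ℝ) 1, HasDerivAt f' (f'' x) x)
    (hf''c : ContinuousOn f'' (Set.Ioo (-1) 1)) (hf0 : f 0 = 0) {α : ℝ} (hα : α ∈ Set.Icc (-1 : ℝ) 1) :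
    IsMatrixMonotoneOn (fun x => f x + α * dd1 f x 0) (Set.Ioo (-1) 1) := by
  intro n A B hA hB hAs hBs hAB
  -- Step 0: nested intervals `[c,d] ⊂ (c',d') ⊂ [c',d'] ⊂ (-1,1)` around the spectra and `0`
  set S : Set ℝ := spectrum ℝ A ∪ spectrum ℝ B ∪ {0} with hS
  have hSfin : S.Finite := ((Matrix.finite_real_spectrum (A := A)).union
    (Matrix.finite_real_spectrum (A := B))).union (Set.finite_singleton 0)
  have hS1 : S ⊆ Set.Ioo (-1) 1 := Set.union_subset (Set.union_subset hAs hBs)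
    (by simp)
  have hne : hSfin.toFinset.Nonempty := ⟨0, hSfin.mem_toFinset.mpr (by simp [hS])⟩
  set M : ℝ := (hSfin.toFinset.image fun x => |x|).max' (hne.image _) with hM
  have hMmem : M ∈ hSfin.toFinset.image fun x => |x| := Finset.max'_mem _ _
  obtain ⟨x₀, hx₀, hx₀M⟩ := Finset.mem_image.mp hMmem
  have hM1 : M < 1 := by
    rw [← hx₀M]
    have := hS1 (hSfin.mem_toFinset.mp hx₀)
    exact abs_lt.mpr ⟨by linarith [this.1], this.2⟩
  have hM0 : 0 ≤ M := by rw [← hx₀M]; exact abs_nonneg _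
  have hSM : ∀ x ∈ S, |x| ≤ M := fun x hx =>
    Finset.le_max' _ _ (Finset.mem_image_of_mem _ (hSfin.mem_toFinset.mpr hx))
  set d : ℝ := (2 * M + 1) / 3 with hd
  set d' : ℝ := (M + 2) / 3 with hd'
  have hd0 : 0 < d := by rw [hd]; linarith
  have hdd' : d < d' := by rw [hd, hd']; linarith
  have hd'1 : d' < 1 := by rw [hd']; linarith
  have hMd : M < d := by rw [hd]; linarith
  have hIcc : Set.Icc (-d') d' ⊆ Set.Ioo (-1 : ℝ) 1 := fun x hx => ⟨by linarith [hx.1], by linarith [hx.2]⟩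
  have hspecA : spectrum ℝ A ⊆ Set.Icc (-d) d := fun x hx => by
    have := hSM x (Or.inl (Or.inl hx)); rw [abs_le] at this; constructor <;> linarith [this.1, this.2]
  have hspecB : spectrum ℝ B ⊆ Set.Icc (-d) d := fun x hx => by
    have := hSM x (Or.inl (Or.inr hx)); rw [abs_le] at this; constructor <;> linarith [this.1, this.2]
  -- derivatives on `[c', d']`
  have hfd' : ∀ x ∈ Set.Icc (-d') d', HasDerivAt f (f' x) x := fun x hx => hfd x (hIcc hx)
  have hf'd' : ∀ x ∈ Set.Icc (-d') d', HasDerivAt f' (f'' x) x := fun x hx => hf'd x (hIcc hx)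
  have hf''c' : ContinuousOn f'' (Set.Icc (-d') d') := hf''c.mono hIcc
  -- the convex functions `p± = (x ± 1) f` and their second derivatives
  have hpp := isMatrixConvexOn_add_one_mul hf
  have hpm := isMatrixConvexOn_sub_one_mul hf
  have hppd : ∀ x ∈ Set.Icc (-d') d', HasDerivAt (fun x => (x + 1) * f x) (f x + (x + 1) * f' x) x := by
    intro x hx
    have h := ((hasDerivAt_id' x).add_const 1).mul (hfd' x hx)
    simp only [one_mul] at h
    exact h
  have hpmd : ∀ x ∈ Set.Icc (-d') d', HasDerivAt (fun x => (x - 1) * f x) (f x + (x - 1) * f' x) x := by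
    intro x hx
    have h := ((hasDerivAt_id' x).sub_const 1).mul (hfd' x hx)
    simp only [one_mul] at h
    exact h
  have hppdd : ∀ x ∈ Set.Icc (-d') d',
      HasDerivAt (fun x => f x + (x + 1) * f' x) (2 * f' x + (x + 1) * f'' x) x := by
    intro x hx
    have h := (hfd' x hx).add (((hasDerivAt_id' x).add_const 1).mul (hf'd' x hx))
    have e : f' x + (1 * f' x + (x + 1) * f'' x) = 2 * f' x + (x + 1) * f'' x := by ring
    rw [e] at h
    exact h
  have hpmdd : ∀ x ∈ Set.Icc (-d') d',
      HasDerivAt (fun x => f x + (x - 1) * f' x) (2 * f' x + (x - 1) * f'' x) x := by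
    intro x hx
    have h := (hfd' x hx).add (((hasDerivAt_id' x).sub_const 1).mul (hf'd' x hx))
    have e : f' x + (1 * f' x + (x - 1) * f'' x) = 2 * f' x + (x - 1) * f'' x := by ring
    rw [e] at h
    exact h
  -- target: Hermitian, reduce to quadratic forms and to `ε → 0`
  set q : ℝ → ℝ := fun x => f x + α * dd1 f x 0 with hq
  have hherm : (cfc q B - cfc q A).IsHermitian :=
    (cfc_predicate q B : IsSelfAdjoint _).sub (cfc_predicate q A : IsSelfAdjoint _)
  rw [posSemidef_iff_qform hherm]
  intro w
  set W : ℝ := ∑ a, ‖w a‖ ^ 2 with hW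
  have hW0 : 0 ≤ W := Finset.sum_nonneg fun _ _ => by positivity
  set N : ℝ := (n : ℝ) with hN
  set Ckr : ℝ := 4 * N ^ 2 * (N + 1) ^ 6 with hCkr
  set Ctot : ℝ := (16 * Ckr * (N ^ 2 * entrySum (B - A)) + 6) * W with hCtot
  have hCtot0 : 0 ≤ Ctot := by have := entrySum_nonneg (B - A); positivity
  suffices key : ∀ ε : ℝ, 0 < ε → -(Ctot * ε) ≤ qform (cfc q B - cfc q A) w by
    set qv := qform (cfc q B - cfc q A) w with hqv
    by_contra hneg
    push Not at hneg
    have hε : 0 < -qv / (Ctot + 1) := div_pos (by linarith) (by linarith)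
    have h1 := key _ hε
    have h2 : -(Ctot * (-qv / (Ctot + 1))) = Ctot * qv / (Ctot + 1) := by ring
    rw [h2, div_le_iff₀ (by linarith)] at h1
    nlinarith
  intro ε hε
  -- Step 1: the polynomial `P` (C²-close to `f` on `[c',d']`, `P(0) = 0`)
  obtain ⟨P₀, hP₀⟩ := exists_polynomial_C2_near (by linarith : (-d' : ℝ) ≤ d') hfd' hf'd' hf''c' hε
  set P : ℝ[X] := P₀ - C (P₀.eval 0) with hPdef
  have h0mem : (0 : ℝ) ∈ Set.Icc (-d') d' := ⟨by linarith, by linarith⟩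
  have hP0 : P.eval 0 = 0 := by simp [hPdef]
  have hPd1 : P.derivative = P₀.derivative := by simp [hPdef]
  have hPf : ∀ x ∈ Set.Icc (-d') d', |P.eval x - f x| ≤ 2 * ε := by
    intro x hx
    have h1 := (hP₀ x hx).1
    have h2 := (hP₀ 0 h0mem).1
    rw [hf0, sub_zero] at h2
    simp only [hPdef, eval_sub, eval_C]
    calc |P₀.eval x - P₀.eval 0 - f x| = |(P₀.eval x - f x) - P₀.eval 0| := by ring_nf
      _ ≤ |P₀.eval x - f x| + |P₀.eval 0| := abs_sub _ _
      _ ≤ ε + ε := add_le_add h1 h2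
      _ = 2 * ε := by ring
  have hPf' : ∀ x ∈ Set.Icc (-d') d', |P.derivative.eval x - f' x| ≤ ε := fun x hx => by
    rw [hPd1]; exact (hP₀ x hx).2.1
  have hPf'' : ∀ x ∈ Set.Icc (-d') d', |P.derivative.derivative.eval x - f'' x| ≤ ε := fun x hx => by
    rw [hPd1]; exact (hP₀ x hx).2.2
  -- Step 2: Kraus bounds for `Π± = (X ± 1) P`
  have hPip : ∀ x ∈ Set.Icc (-d') d',
      |((X + C 1) * P).derivative.derivative.eval x - (2 * f' x + (x + 1) * f'' x)| ≤ 4 * ε := by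
    intro x hx
    rw [eval_derivative_derivative_X_add_C_mul]
    have h1 := hPf' x hx; have h2 := hPf'' x hx
    have hx1 : |x + 1| ≤ 2 := by rw [abs_le]; constructor <;> linarith [hx.1, hx.2]
    calc |2 * P.derivative.eval x + (x + 1) * P.derivative.derivative.eval x - (2 * f' x + (x + 1) * f'' x)|
        = |2 * (P.derivative.eval x - f' x) + (x + 1) * (P.derivative.derivative.eval x - f'' x)| := by ring_nf
      _ ≤ |2 * (P.derivative.eval x - f' x)| + |(x + 1) * (P.derivative.derivative.eval x - f'' x)| :=
          abs_add_le _ _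
      _ ≤ 2 * ε + 2 * ε := by
          rw [abs_mul, abs_mul, abs_two]
          gcongr
      _ = 4 * ε := by ring
  have hPim : ∀ x ∈ Set.Icc (-d') d',
      |((X - C 1) * P).derivative.derivative.eval x - (2 * f' x + (x - 1) * f'' x)| ≤ 4 * ε := by
    intro x hx
    rw [eval_derivative_derivative_X_sub_C_mul]
    have h1 := hPf' x hx; have h2 := hPf'' x hx
    have hx1 : |x - 1| ≤ 2 := by rw [abs_le]; constructor <;> linarith [hx.1, hx.2]
    calc |2 * P.derivative.eval x + (x - 1) * P.derivative.derivative.eval x - (2 * f' x + (x - 1) * f'' x)|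
        = |2 * (P.derivative.eval x - f' x) + (x - 1) * (P.derivative.derivative.eval x - f'' x)| := by ring_nf
      _ ≤ |2 * (P.derivative.eval x - f' x)| + |(x - 1) * (P.derivative.derivative.eval x - f'' x)| :=
          abs_add_le _ _
      _ ≤ 2 * ε + 2 * ε := by
          rw [abs_mul, abs_mul, abs_two]
          gcongr
      _ = 4 * ε := by ring
  have hkr : ∀ lam : Fin n → ℝ, (∀ i, lam i ∈ Set.Icc (-d) d) → ∀ v : Fin n → ℂ,
      -(Ckr * (4 * ε) * ∑ a, ‖v a‖ ^ 2) ≤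
        qform (Matrix.of fun i j => (polyDD2 ((X + C 1) * P) (lam i) 0 (lam j) : ℂ)) v ∧
      -(Ckr * (4 * ε) * ∑ a, ‖v a‖ ^ 2) ≤
        qform (Matrix.of fun i j => (polyDD2 ((X - C 1) * P) (lam i) 0 (lam j) : ℂ)) v := by
    intro lam hlam v
    have hlam' : ∀ i, lam i ∈ Set.Ioo (-d') d' := fun i => ⟨by linarith [(hlam i).1], by linarith [(hlam i).2]⟩
    have h0' : (0 : ℝ) ∈ Set.Ioo (-d') d' := ⟨by linarith, by linarith⟩
    have hε4 : 0 ≤ 4 * ε := by linarith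
    have k1 := kraus_qform_ge hpp hIcc hppd hppdd h0' lam hlam' hε4 hPip v
    have k2 := kraus_qform_ge hpm hIcc hpmd hpmdd h0' lam hlam' hε4 hPim v
    simp only [Fintype.card_fin, ← hN, ← hCkr] at k1 k2
    exact ⟨by linarith, by linarith⟩
  -- Step 3: the polynomial `Q = P + α P/X` and its approximate Loewner criterion
  set Q : ℝ[X] := P + α • divX P with hQ
  have hLQ : ∀ lam : Fin n → ℝ, (∀ i, lam i ∈ Set.Icc (-d) d) → ∀ v : Fin n → ℂ,
      -(16 * Ckr * ε * ∑ a, ‖v a‖ ^ 2) ≤ qform (Matrix.of fun i j => (polyDD1 Q (lam i) (lam j) : ℂ)) v := by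
    intro lam hlam v
    obtain ⟨k1, k2⟩ := hkr lam hlam v
    have hdec : (Matrix.of fun i j => (polyDD1 Q (lam i) (lam j) : ℂ)) =
        (((1 + α) / 2 : ℝ) : ℂ) • (Matrix.of fun i j => (polyDD2 ((X + C 1) * P) (lam i) 0 (lam j) : ℂ)) +
        (((1 - α) / 2 : ℝ) : ℂ) • (Matrix.of fun i j => (polyDD2 ((X - C 1) * P) (lam i) 0 (lam j) : ℂ)) := by
      ext i j
      simp only [Matrix.of_apply, Matrix.add_apply, Matrix.smul_apply, smul_eq_mul, hQ, polyDD1_add,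
        polyDD1_smul, polyDD1_divX hP0, polyDD2_X_add_one_mul, polyDD2_X_sub_one_mul]
      push_cast; ring
    rw [hdec, qform_add, qform_smul, qform_smul]
    have ha : 0 ≤ (1 + α) / 2 := by linarith [hα.1]
    have hb : 0 ≤ (1 - α) / 2 := by linarith [hα.2]
    have hV : 0 ≤ ∑ a, ‖v a‖ ^ 2 := Finset.sum_nonneg fun _ _ => by positivity
    have hpos : 0 ≤ Ckr * (4 * ε) * ∑ a, ‖v a‖ ^ 2 := by positivity
    have h1 := mul_le_mul_of_nonneg_left k1 ha
    have h2 := mul_le_mul_of_nonneg_left k2 hb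
    linarith
  have hε16 : 0 ≤ 16 * Ckr * ε := by positivity
  have hmain := qform_aeval_sub_aeval_ge (ι := Fin n) hε16 hLQ hA hB hspecA hspecB hAB w
  simp only [Fintype.card_fin, ← hN, ← hW] at hmain
  -- Step 4: `Q` is uniformly `3ε`-close to `q` on `[c,d]`
  have hclose : ∀ x ∈ Set.Icc (-d) d, |Q.eval x - q x| ≤ 3 * ε := by
    intro x hx
    have hx' : x ∈ Set.Icc (-d') d' := ⟨by linarith [hx.1], by linarith [hx.2]⟩
    simp only [hQ, hq, eval_add, eval_smul, smul_eq_mul]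
    have h1 := hPf x hx'
    -- the divided-difference part
    have h2 : |(divX P).eval x - dd1 f x 0| ≤ ε := by
      by_cases hx0 : x = 0
      · subst hx0
        rw [eval_divX_zero, dd1_self, (hfd 0 (hIcc h0mem)).deriv]
        exact hPf' 0 h0mem
      · have e1 : (divX P).eval x = (P.eval x - P.eval 0) / x := by
          rw [eq_div_iff hx0]; exact eval_divX_mul x
        rw [e1, hP0, sub_zero, dd1_of_ne f hx0, hf0, sub_zero, sub_zero, ← sub_div]
        -- mean value on `[c', d']` for `φ = P - f`, between `0` and `x`
        have hφ : ∀ t ∈ Set.Icc (-d') d', HasDerivAt (fun t => P.eval t - f t) (P.derivative.eval t - f' t) t :=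
          fun t ht => (P.hasDerivAt t).sub (hfd' t ht)
        have hb : ∀ t ∈ Set.Icc (-d') d', |deriv (fun t => P.eval t - f t) t| ≤ ε := fun t ht => by
          rw [(hφ t ht).deriv]; exact hPf' t ht
        have := abs_dd1_le (fun t ht => (hφ t ht).differentiableAt) hb hx' h0mem
        rwa [dd1_of_ne _ hx0, hP0, hf0, sub_zero, sub_zero, sub_zero] at this
    calc |P.eval x + α * (divX P).eval x - (f x + α * dd1 f x 0)|
        = |(P.eval x - f x) + α * ((divX P).eval x - dd1 f x 0)| := by ring_nf
      _ ≤ |P.eval x - f x| + |α * ((divX P).eval x - dd1 f x 0)| := abs_add_le _ _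
      _ ≤ 2 * ε + 1 * ε := by
          rw [abs_mul]
          gcongr
          exact abs_le.mpr ⟨by linarith [hα.1], hα.2⟩
      _ = 3 * ε := by ring
  -- Step 5: compare quadratic forms
  have hQA : |qform (cfc (fun x => Q.eval x) A) w - qform (cfc q A) w| ≤ 3 * ε * W :=
    abs_qform_cfc_sub_le hA (fun x hx => hclose x (hspecA hx)) w
  have hQB : |qform (cfc (fun x => Q.eval x) B) w - qform (cfc q B) w| ≤ 3 * ε * W :=
    abs_qform_cfc_sub_le hB (fun x hx => hclose x (hspecB hx)) w
  erw [cfc_polynomial Q A (hA : IsSelfAdjoint _)] at hQA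
  erw [cfc_polynomial Q B (hB : IsSelfAdjoint _)] at hQB
  rw [qform_sub] at hmain ⊢
  rw [abs_le] at hQA hQB
  have : Ctot * ε = 16 * Ckr * ε * (N ^ 2 * entrySum (B - A)) * W + 3 * ε * W + 3 * ε * W := by
    rw [hCtot]; ring
  rw [this]
  linarith [hQA.1, hQA.2, hQB.1, hQB.2]

end Lemma434c

end Literature.Analysis.Complex
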